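import Literature.NumberTheory.LFunctions.MontgomeryOffDiagonalTools
import Literature.NumberTheory.LFunctions.MontgomeryCoefficientSums
import HarnessLib

/-!
# The off-diagonal terms in the mean square of Montgomery's Dirichlet series

Trunk T-ANT (`Literature/NumberTheory/LFunctions`). Proofs only (no definitions, no named facts).
The arithmetic half of the discharge of the named fact (P3) `montgomery_dirichletSum_meanSquare`
(`MontgomeryPairCorrelation.lean`; Goldston 2005, (4.6): "`∫_0^T |∑ Λ(n)a_n(x) n^{-it}|² dt =
∑ |Λ(n) a_n(x)|² (T + O(n)) = xT(log x + O(1)) + O(x² log x)`", by the Montgomery–Vaughan mean value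
theorem). Integrating termwise (`DirichletPolynomialOffDiagonalMVT.lean`) leaves the off-diagonal sum
`∑_{m ≠ n} a_m a_n · 2/|log n − log m|`, `a_n = Λ(n) a_n(x) = Λ(n) min((n/x)^{1/2}, (x/n)^{3/2})`
(`montgomeryCoeff`), and the printed `O(x² log x)` is recovered here WITHOUT the weighted Hilbert
inequality, from the support of the coefficients on prime powers:

* `Montgomery.exists_offDiag_montgomeryCoeff_le` — there is an absolute `C` with
  `∑_{m ≠ n ≤ N} a_m a_n · 2/|log n − log m| ≤ C x² (log x + 1)` for all `x ≥ 1` and all `N`.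

Proof. By symmetry it is twice the sum over `m < n = m + h`. For `h ≥ m`, `2/log(1 + h/m) ≤ 2/log 2 ≤ 3`,
and these pairs contribute `≤ 3 (∑_n a_n)² ≪ x²` (`Montgomery.sum_Icc_montgomeryCoeff_le`:
`∑_{n ≤ N} a_n ≤ 13(log 4 + 4) x`, Chebyshev). For `h < m`, `2/log(1 + h/m) ≤ 4m/h` and
`a_n(x) ≤ 2 a_m(x)` (`n ≤ 2m`), so these pairs contribute
`≤ 8 ∑_h h⁻¹ ∑_{m > h} Λ(m)Λ(m+h) min(m²/x, x³/m²)`; by the prime-pair sieve bound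
`∑_{h < m ≤ M} Λ(m)Λ(m+h) ≤ C (h/φ(h)) M` (`Montgomery.exists_sum_Ioc_vonMangoldt_mul_shift_le`) and
dyadic summation the inner sum is `≤ 9C (h/φ(h)) x²` for `h ≤ x` and `≤ 4C x³ (h/φ(h))/h` for `h > x`,
and `∑_{h ≤ x} 1/φ(h) ≪ 1 + log x`, `∑_{h > x} (h/φ(h))/h² ≪ 1/x` finish the proof.

## References

* D. A. Goldston, *Notes on pair correlation of zeros and prime numbers*, LMS Lecture Note Ser. 322
  (2005), §4, (4.6) and the display after it.
* H. L. Montgomery, *The pair correlation of zeros of the zeta function*, Proc. Sympos. Pure Math.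
  24 (1973), 181–193, §3.
* H. L. Montgomery, R. C. Vaughan, *Hilbert's inequality*, J. London Math. Soc. (2) 8 (1974),
  Cor. 3 (the mean value theorem whose rôle is played here by the prime-pair sieve bound).
-/

noncomputable section

open Finset Real
open ArithmeticFunction hiding log id
open scoped Chebyshev

namespace Literature.NumberTheory.LFunctions

namespace Montgomery

/-! ## The weights `a_n(x) = min((n/x)^{1/2}, (x/n)^{3/2})` -/

/-- `(x/n)^{3/2} = x√x/(n√n)` (`x, n > 0`; `y^{3/2} = y^{1 + 1/2} = y √y`, cf.
`Literature.Barriers.MatrixMultiplication.rpow_three_halves`). [folklore] -/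
theorem div_rpow_three_halves {x : ℝ} (hx : 0 < x) {n : ℝ} (hn : 0 < n) :
    (x / n) ^ (3 / 2 : ℝ) = x * Real.sqrt x / (n * Real.sqrt n) := by
  have h : ∀ y : ℝ, 0 < y → y ^ (3 / 2 : ℝ) = y * Real.sqrt y := fun y hy ↦ by
    rw [Real.sqrt_eq_rpow, show (3 / 2 : ℝ) = 1 + 1 / 2 by norm_num, Real.rpow_add hy, Real.rpow_one]
  rw [Real.div_rpow hx.le hn.le, h x hx, h n hn]

/-- `a_n(x) ≤ 1` for `n ≤ x`. [folklore] -/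
theorem weight_le_one {x : ℝ} (hx : 0 < x) {n : ℝ} (hn : 0 ≤ n) (hnx : n ≤ x) :
    min ((n / x) ^ (1 / 2 : ℝ)) ((x / n) ^ (3 / 2 : ℝ)) ≤ 1 :=
  (min_le_left _ _).trans (Real.rpow_le_one (by positivity) ((div_le_one hx).2 hnx) (by norm_num))

/-- `a_n(x) ≤ 2 a_m(x)` for `m ≤ n ≤ 4m` (`(n/x)^{1/2} ≤ 2 (m/x)^{1/2}`, `(x/n)^{3/2} ≤ (x/m)^{3/2}`).
[folklore] -/
theorem weight_shift_le {x : ℝ} (hx : 0 < x) {m n : ℝ} (hm : 0 < m) (hmn : m ≤ n)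
    (hn4 : n ≤ 4 * m) :
    min ((n / x) ^ (1 / 2 : ℝ)) ((x / n) ^ (3 / 2 : ℝ)) ≤
      2 * min ((m / x) ^ (1 / 2 : ℝ)) ((x / m) ^ (3 / 2 : ℝ)) := by
  have hn : 0 < n := lt_of_lt_of_le hm hmn
  have hp : (n / x) ^ (1 / 2 : ℝ) ≤ 2 * (m / x) ^ (1 / 2 : ℝ) := by
    have h0 : n / x ≤ 4 * (m / x) := by
      rw [mul_div_assoc']; exact div_le_div_of_nonneg_right hn4 hx.le
    have h1 : (n / x) ^ (1 / 2 : ℝ) ≤ (4 * (m / x)) ^ (1 / 2 : ℝ) :=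
      Real.rpow_le_rpow (by positivity) h0 (by norm_num)
    have h2 : (4 * (m / x)) ^ (1 / 2 : ℝ) = 2 * (m / x) ^ (1 / 2 : ℝ) := by
      rw [Real.mul_rpow (by norm_num) (by positivity)]
      congr 1
      rw [show (4 : ℝ) = 2 ^ (2 : ℕ) by norm_num, ← Real.rpow_natCast,
        ← Real.rpow_mul (by norm_num)]
      norm_num
    exact h1.trans h2.le
  have hq : (x / n) ^ (3 / 2 : ℝ) ≤ (x / m) ^ (3 / 2 : ℝ) :=
    Real.rpow_le_rpow (by positivity) (div_le_div_of_nonneg_left hx.le hm hmn) (by norm_num)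
  have hq0 : 0 ≤ (x / m) ^ (3 / 2 : ℝ) := by positivity
  rcases le_total ((m / x) ^ (1 / 2 : ℝ)) ((x / m) ^ (3 / 2 : ℝ)) with h | h
  · rw [min_eq_left h]; exact (min_le_left _ _).trans hp
  · rw [min_eq_right h]; exact (min_le_right _ _).trans (hq.trans (by linarith))

/-- `Λ(n) a_n(x) ≤ Λ(n)` for `n ≤ x`. [folklore] -/
theorem montgomeryCoeff_le_vonMangoldt {x : ℝ} (hx : 0 < x) {n : ℕ} (hnx : (n : ℝ) ≤ x) :
    montgomeryCoeff x n ≤ Λ n := by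
  unfold montgomeryCoeff
  exact mul_le_of_le_one_right vonMangoldt_nonneg (weight_le_one hx (Nat.cast_nonneg n) hnx)

/-- `Λ(n) a_n(x) ≤ Λ(n) x√x/(n√n)` for `n ≥ 1`. [folklore] -/
theorem montgomeryCoeff_le_mul_div {x : ℝ} (hx : 0 < x) {n : ℕ} (hn : 1 ≤ n) :
    montgomeryCoeff x n ≤ Λ n * (x * Real.sqrt x / ((n : ℝ) * Real.sqrt n)) := by
  have hn0 : (0 : ℝ) < n := by exact_mod_cast hn
  unfold montgomeryCoeff
  rw [← div_rpow_three_halves hx hn0]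
  exact mul_le_mul_of_nonneg_left (min_le_right _ _) vonMangoldt_nonneg

/-- **The near-diagonal products**: for `1 ≤ m` and `h ≤ m`,
`m · (Λ(m)a_m(x)) (Λ(m+h)a_{m+h}(x)) ≤ 2 Λ(m) Λ(m+h) min(m²/x, x³/m²)`
(`a_{m+h} ≤ 2 a_m` and `m a_m(x)² = min(m²/x, x³/m²)`). [folklore] -/
theorem mul_montgomeryCoeff_mul_shift_le {x : ℝ} (hx : 0 < x) {m h : ℕ} (hm : 1 ≤ m) (hhm : h ≤ m) :
    (m : ℝ) * (montgomeryCoeff x m * montgomeryCoeff x (m + h)) ≤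
      2 * Λ m * Λ (m + h) * min ((m : ℝ) ^ 2 / x) (x ^ 3 / (m : ℝ) ^ 2) := by
  have hm0 : (0 : ℝ) < m := by exact_mod_cast hm
  have hhm' : (h : ℝ) ≤ m := by exact_mod_cast hhm
  set wm := min (((m : ℝ) / x) ^ (1 / 2 : ℝ)) ((x / m) ^ (3 / 2 : ℝ)) with hwm
  set wn := min ((((m + h : ℕ) : ℝ) / x) ^ (1 / 2 : ℝ)) ((x / ((m + h : ℕ) : ℝ)) ^ (3 / 2 : ℝ))
    with hwn
  have hwm0 : 0 ≤ wm := le_min (by positivity) (by positivity)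
  have hwn_le : wn ≤ 2 * wm :=
    weight_shift_le hx hm0 (by push_cast; linarith) (by push_cast; linarith)
  have hsq : wm ^ 2 = min ((m : ℝ) / x) (x ^ 3 / (m : ℝ) ^ 3) := by
    simp only [hwm]
    rw [min_sq_eq (Real.rpow_nonneg (by positivity) _) (Real.rpow_nonneg (by positivity) _)]
    congr 1
    · rw [← Real.rpow_natCast, ← Real.rpow_mul (by positivity)]; norm_num
    · rw [← Real.rpow_natCast, ← Real.rpow_mul (by positivity)]
      norm_num
      rw [div_pow]
  have hmmin : (m : ℝ) * min ((m : ℝ) / x) (x ^ 3 / (m : ℝ) ^ 3) =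
      min ((m : ℝ) ^ 2 / x) (x ^ 3 / (m : ℝ) ^ 2) := by
    rw [mul_min_of_nonneg _ _ hm0.le]
    congr 1
    · ring
    · field_simp
  have hΛ0 : 0 ≤ Λ m * Λ (m + h) := mul_nonneg vonMangoldt_nonneg vonMangoldt_nonneg
  have e : montgomeryCoeff x m * montgomeryCoeff x (m + h) = Λ m * Λ (m + h) * wn * wm := by
    simp only [montgomeryCoeff, hwm, hwn]; ring
  rw [e]
  calc (m : ℝ) * (Λ m * Λ (m + h) * wn * wm) = Λ m * Λ (m + h) * wn * ((m : ℝ) * wm) := by ring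
    _ ≤ Λ m * Λ (m + h) * (2 * wm) * ((m : ℝ) * wm) :=
        mul_le_mul_of_nonneg_right (mul_le_mul_of_nonneg_left hwn_le hΛ0) (by positivity)
    _ = 2 * Λ m * Λ (m + h) * ((m : ℝ) * wm ^ 2) := by ring
    _ = 2 * Λ m * Λ (m + h) * min ((m : ℝ) ^ 2 / x) (x ^ 3 / (m : ℝ) ^ 2) := by rw [hsq, hmmin]

/-! ## The kernel `2/|log n − log m|` -/

/-- For `1 ≤ m`, `1 ≤ h`: `2/|log(m+h) − log m| ≤ 3 + [h < m] · 4m/h`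
(`log(1 + h/m) ≥ log 2` if `h ≥ m`, and `log(1 + h/m) ≥ h/(m+h) ≥ h/(2m)` if `h < m`). [folklore] -/
theorem two_div_abs_log_sub_log_le {m h : ℕ} (hm : 1 ≤ m) (hh : 1 ≤ h) :
    2 / |Real.log ((m + h : ℕ) : ℝ) - Real.log m| ≤ 3 + (if h < m then 4 * (m : ℝ) / h else 0) := by
  have hm0 : (0 : ℝ) < m := by exact_mod_cast hm
  have hh0 : (0 : ℝ) < h := by exact_mod_cast hh
  have hL : Real.log ((m + h : ℕ) : ℝ) - Real.log m = Real.log (((m : ℝ) + h) / m) := by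
    push_cast
    rw [Real.log_div (by positivity) hm0.ne']
  have hLpos : 0 < Real.log (((m : ℝ) + h) / m) :=
    Real.log_pos (by rw [lt_div_iff₀ hm0]; linarith)
  rw [hL, abs_of_pos hLpos]
  by_cases hlt : h < m
  · rw [if_pos hlt]
    have h1 : 1 - (((m : ℝ) + h) / m)⁻¹ ≤ Real.log (((m : ℝ) + h) / m) :=
      Real.one_sub_inv_le_log_of_pos (by positivity)
    rw [inv_div] at h1
    have e : 1 - (m : ℝ) / (m + h) = h / (m + h) := by field_simp; ring
    rw [e] at h1
    have h2 : (h : ℝ) / (2 * m) ≤ h / (m + h) :=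
      div_le_div_of_nonneg_left hh0.le (by positivity)
        (by have : (h : ℝ) ≤ m := by exact_mod_cast hlt.le
            linarith)
    have h3 : (h : ℝ) / (2 * m) ≤ Real.log (((m : ℝ) + h) / m) := h2.trans h1
    have h4 : (0 : ℝ) ≤ 4 * m / h := by positivity
    calc 2 / Real.log (((m : ℝ) + h) / m) ≤ 2 / ((h : ℝ) / (2 * m)) :=
          div_le_div_of_nonneg_left (by norm_num) (by positivity) h3
      _ = 4 * m / h := by field_simp; ring
      _ ≤ 3 + 4 * m / h := by linarith
  · rw [if_neg hlt, add_zero]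
    push Not at hlt
    have hle : (m : ℝ) ≤ h := by exact_mod_cast hlt
    have h1 : Real.log 2 ≤ Real.log (((m : ℝ) + h) / m) :=
      Real.log_le_log two_pos (by rw [le_div_iff₀ hm0]; linarith)
    have hl2 : (0.6931471803 : ℝ) < Real.log 2 := Real.log_two_gt_d9
    calc 2 / Real.log (((m : ℝ) + h) / m) ≤ 2 / Real.log 2 :=
          div_le_div_of_nonneg_left (by norm_num) (by linarith) h1
      _ ≤ 3 := by rw [div_le_iff₀ (by linarith)]; linarith

/-! ## `∑ a_n ≪ x` -/

/-- **`∑_{n ≤ M} Λ(n) a_n(x) ≤ 13 (log 4 + 4) x`** for `x ≥ 1` and all `M`: the `n ≤ x` contribute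
`≤ ψ(x)`, and the tail `x^{3/2} ∑_{n > x} Λ(n) n^{-3/2} ≤ 8 (log 4 + 4) x^{3/2}/√⌊x⌋` by dyadic
summation (`sum_Ioc_div_mul_sqrt_le_of_chebyshev`). [folklore] -/
theorem sum_Icc_montgomeryCoeff_le {x : ℝ} (hx : 1 ≤ x) (M : ℕ) :
    ∑ n ∈ Finset.Icc 1 M, montgomeryCoeff x n ≤ 13 * (Real.log 4 + 4) * x := by
  have hx0 : 0 < x := by linarith
  set X : ℕ := ⌊x⌋₊ with hX
  have hX1 : 1 ≤ X := Nat.le_floor (by simpa using hx)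
  have hXx : (X : ℝ) ≤ x := Nat.floor_le hx0.le
  have hxX : x < X + 1 := Nat.lt_floor_add_one x
  have hX0 : (0 : ℝ) < X := by exact_mod_cast hX1
  have hX1r : (1 : ℝ) ≤ X := by exact_mod_cast hX1
  set Cψ : ℝ := Real.log 4 + 4 with hCψ
  have hCψ0 : 0 < Cψ := by have := Real.log_pos (by norm_num : (1 : ℝ) < 4); positivity
  -- split at `X`
  rw [← Finset.sum_filter_add_sum_filter_not (Finset.Icc 1 M) (fun n ↦ n ≤ X)]
  -- the low part
  have hlow : ∑ n ∈ (Finset.Icc 1 M).filter (fun n ↦ n ≤ X), montgomeryCoeff x n ≤ Cψ * x := by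
    calc ∑ n ∈ (Finset.Icc 1 M).filter (fun n ↦ n ≤ X), montgomeryCoeff x n
        ≤ ∑ n ∈ (Finset.Icc 1 M).filter (fun n ↦ n ≤ X), Λ n := by
          refine Finset.sum_le_sum fun n hn ↦ ?_
          rw [Finset.mem_filter] at hn
          exact montgomeryCoeff_le_vonMangoldt hx0 ((Nat.cast_le.2 hn.2).trans hXx)
      _ ≤ ∑ n ∈ Finset.Icc 1 X, Λ n := by
          refine Finset.sum_le_sum_of_subset_of_nonneg (fun n hn ↦ ?_) fun _ _ _ ↦ vonMangoldt_nonneg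
          rw [Finset.mem_filter, Finset.mem_Icc] at hn
          rw [Finset.mem_Icc]; omega
      _ ≤ Cψ * X := sum_Icc_vonMangoldt_le X
      _ ≤ Cψ * x := mul_le_mul_of_nonneg_left hXx hCψ0.le
  -- the high part
  have hhigh : ∑ n ∈ (Finset.Icc 1 M).filter (fun n ↦ ¬n ≤ X), montgomeryCoeff x n ≤ 12 * Cψ * x := by
    have h1 : ∑ n ∈ (Finset.Icc 1 M).filter (fun n ↦ ¬n ≤ X), montgomeryCoeff x n ≤
        ∑ n ∈ Finset.Ioc X M, Λ n * (x * Real.sqrt x / ((n : ℝ) * Real.sqrt n)) := by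
      calc ∑ n ∈ (Finset.Icc 1 M).filter (fun n ↦ ¬n ≤ X), montgomeryCoeff x n
          ≤ ∑ n ∈ (Finset.Icc 1 M).filter (fun n ↦ ¬n ≤ X),
              Λ n * (x * Real.sqrt x / ((n : ℝ) * Real.sqrt n)) := by
            refine Finset.sum_le_sum fun n hn ↦ ?_
            rw [Finset.mem_filter, Finset.mem_Icc] at hn
            exact montgomeryCoeff_le_mul_div hx0 hn.1.1
        _ ≤ ∑ n ∈ Finset.Ioc X M, Λ n * (x * Real.sqrt x / ((n : ℝ) * Real.sqrt n)) := by
            refine Finset.sum_le_sum_of_subset_of_nonneg (fun n hn ↦ ?_) fun _ _ _ ↦ ?_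
            · rw [Finset.mem_filter, Finset.mem_Icc] at hn
              rw [Finset.mem_Ioc]; omega
            · exact mul_nonneg vonMangoldt_nonneg (by positivity)
    have h2 : ∑ n ∈ Finset.Ioc X M, Λ n * (x * Real.sqrt x / ((n : ℝ) * Real.sqrt n)) =
        x * Real.sqrt x * ∑ n ∈ Finset.Ioc X M, Λ n / ((n : ℝ) * Real.sqrt n) := by
      rw [Finset.mul_sum]
      refine Finset.sum_congr rfl fun n _ ↦ ?_
      ring
    have h3 : ∑ n ∈ Finset.Ioc X M, Λ n / ((n : ℝ) * Real.sqrt n) ≤ 8 * Cψ / Real.sqrt X :=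
      sum_Ioc_div_mul_sqrt_le_of_chebyshev hX1 (fun _ ↦ vonMangoldt_nonneg)
        (fun M' ↦ sum_Icc_vonMangoldt_le M') M
    have hsX : 0 < Real.sqrt X := Real.sqrt_pos.2 hX0
    have h4 : Real.sqrt x ≤ Real.sqrt 2 * Real.sqrt X := by
      rw [← Real.sqrt_mul (by norm_num)]
      exact Real.sqrt_le_sqrt (by linarith)
    have hs2 : Real.sqrt 2 ≤ 3 / 2 := by
      nlinarith [Real.sq_sqrt (show (0 : ℝ) ≤ 2 by norm_num), Real.sqrt_nonneg 2]
    calc ∑ n ∈ (Finset.Icc 1 M).filter (fun n ↦ ¬n ≤ X), montgomeryCoeff x n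
        ≤ x * Real.sqrt x * ∑ n ∈ Finset.Ioc X M, Λ n / ((n : ℝ) * Real.sqrt n) := h2 ▸ h1
      _ ≤ x * Real.sqrt x * (8 * Cψ / Real.sqrt X) :=
          mul_le_mul_of_nonneg_left h3 (by positivity)
      _ ≤ x * (Real.sqrt 2 * Real.sqrt X) * (8 * Cψ / Real.sqrt X) := by gcongr
      _ = 8 * Real.sqrt 2 * Cψ * x := by field_simp
      _ ≤ 12 * Cψ * x := by nlinarith [mul_pos hCψ0 hx0]
  linarith

/-! ## The prime-pair sums `G(h) = ∑_{m > h} Λ(m)Λ(m+h) min(m²/x, x³/m²)` -/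

/-- **The inner sums over prime pairs.** With the absolute constant `C` of
`exists_sum_Ioc_vonMangoldt_mul_shift_le`: for `x ≥ 1`, `X = ⌊x⌋`, `h ≥ 1` and all `N`,
`∑_{h < m ≤ N} Λ(m)Λ(m+h) min(m²/x, x³/m²)` is `≤ 9C (h/φ(h)) x²` if `h ≤ X` and
`≤ 4C x³ (h/φ(h))/h` if `h > X` (the range `m ≤ x` directly from the pair bound, the range `m > x`
by dyadic summation with the weight `1/m²`). [folklore] -/
theorem sum_Ioc_pairTerm_le {C : ℝ} (hC0 : 0 ≤ C)
    (hC : ∀ h : ℕ, 1 ≤ h → ∀ M : ℕ,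
      ∑ m ∈ Finset.Ioc h M, Λ m * Λ (m + h) ≤ C * ((h : ℝ) / Nat.totient h) * M)
    {x : ℝ} (hx : 1 ≤ x) {h : ℕ} (hh : 1 ≤ h) (N : ℕ) :
    ∑ m ∈ Finset.Ioc h N, Λ m * Λ (m + h) * min ((m : ℝ) ^ 2 / x) (x ^ 3 / (m : ℝ) ^ 2) ≤
      if h ≤ ⌊x⌋₊ then 9 * C * ((h : ℝ) / Nat.totient h) * x ^ 2
      else 4 * C * x ^ 3 * ((h : ℝ) / Nat.totient h) / h := by
  have hx0 : 0 < x := by linarith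
  set X : ℕ := ⌊x⌋₊ with hX
  have hX1 : 1 ≤ X := Nat.le_floor (by simpa using hx)
  have hXx : (X : ℝ) ≤ x := Nat.floor_le hx0.le
  have hxX : x < X + 1 := Nat.lt_floor_add_one x
  have hX0 : (0 : ℝ) < X := by exact_mod_cast hX1
  have hX1r : (1 : ℝ) ≤ X := by exact_mod_cast hX1
  have hh0 : (0 : ℝ) < h := by exact_mod_cast hh
  set w : ℝ := (h : ℝ) / Nat.totient h with hw
  have hw0 : 0 ≤ w := by positivity
  -- the shifted products as a function with Chebyshev-type partial sums
  set f : ℕ → ℝ := fun m ↦ if h < m then Λ m * Λ (m + h) else 0 with hf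
  have hf0 : ∀ m, 0 ≤ f m := by
    intro m; simp only [hf]; split_ifs
    · exact mul_nonneg vonMangoldt_nonneg vonMangoldt_nonneg
    · exact le_rfl
  have hF : ∀ M : ℕ, ∑ m ∈ Finset.Icc 1 M, f m ≤ C * w * M := by
    intro M
    have e : ∑ m ∈ Finset.Icc 1 M, f m = ∑ m ∈ Finset.Ioc h M, Λ m * Λ (m + h) := by
      rw [show Finset.Ioc h M = (Finset.Icc 1 M).filter (fun m ↦ h < m) by
        ext m; simp only [Finset.mem_Ioc, Finset.mem_filter, Finset.mem_Icc]; omega]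
      rw [Finset.sum_filter]
    rw [e]; exact hC h hh M
  have hΛΛ0 : ∀ m : ℕ, 0 ≤ Λ m * Λ (m + h) := fun m ↦ mul_nonneg vonMangoldt_nonneg vonMangoldt_nonneg
  have hv0 : ∀ m : ℕ, 0 ≤ min ((m : ℝ) ^ 2 / x) (x ^ 3 / (m : ℝ) ^ 2) := fun m ↦
    le_min (by positivity) (by positivity)
  -- the tail `∑_{Y < m ≤ N} Λ(m)Λ(m+h)/m² ≤ 4 C w / Y` for `Y ≥ h`
  have htail : ∀ Y : ℕ, h ≤ Y → 1 ≤ Y →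
      ∑ m ∈ Finset.Ioc Y N, Λ m * Λ (m + h) * (x ^ 3 / (m : ℝ) ^ 2) ≤ x ^ 3 * (4 * (C * w) / Y) := by
    intro Y hhY hY1
    have h1 := sum_Ioc_div_sq_le_of_chebyshev hY1 hf0 hF N
    have e : ∑ m ∈ Finset.Ioc Y N, Λ m * Λ (m + h) * (x ^ 3 / (m : ℝ) ^ 2) =
        x ^ 3 * ∑ m ∈ Finset.Ioc Y N, f m / (m : ℝ) ^ 2 := by
      rw [Finset.mul_sum]
      refine Finset.sum_congr rfl fun m hm ↦ ?_
      rw [Finset.mem_Ioc] at hm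
      simp only [hf, if_pos (lt_of_le_of_lt hhY hm.1)]
      ring
    rw [e]
    exact mul_le_mul_of_nonneg_left h1 (by positivity)
  split_ifs with hhX
  · -- `h ≤ X`: split the range at `X`
    rw [← Finset.sum_filter_add_sum_filter_not (Finset.Ioc h N) (fun m ↦ m ≤ X)]
    have hlow : ∑ m ∈ (Finset.Ioc h N).filter (fun m ↦ m ≤ X),
        Λ m * Λ (m + h) * min ((m : ℝ) ^ 2 / x) (x ^ 3 / (m : ℝ) ^ 2) ≤ C * w * x ^ 2 := by
      calc ∑ m ∈ (Finset.Ioc h N).filter (fun m ↦ m ≤ X),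
            Λ m * Λ (m + h) * min ((m : ℝ) ^ 2 / x) (x ^ 3 / (m : ℝ) ^ 2)
          ≤ ∑ m ∈ (Finset.Ioc h N).filter (fun m ↦ m ≤ X), Λ m * Λ (m + h) * x := by
            refine Finset.sum_le_sum fun m hm ↦ mul_le_mul_of_nonneg_left ?_ (hΛΛ0 m)
            rw [Finset.mem_filter] at hm
            have hmx : (m : ℝ) ≤ x := (Nat.cast_le.2 hm.2).trans hXx
            refine (min_le_left _ _).trans ?_
            rw [div_le_iff₀ hx0]
            have hm0 : (0 : ℝ) ≤ m := Nat.cast_nonneg m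
            nlinarith
        _ ≤ ∑ m ∈ Finset.Ioc h X, Λ m * Λ (m + h) * x := by
            refine Finset.sum_le_sum_of_subset_of_nonneg (fun m hm ↦ ?_)
              fun m _ _ ↦ mul_nonneg (hΛΛ0 m) hx0.le
            rw [Finset.mem_filter, Finset.mem_Ioc] at hm
            rw [Finset.mem_Ioc]; omega
        _ = (∑ m ∈ Finset.Ioc h X, Λ m * Λ (m + h)) * x := by rw [Finset.sum_mul]
        _ ≤ C * w * X * x := mul_le_mul_of_nonneg_right (hC h hh X) hx0.le
        _ ≤ C * w * x ^ 2 := by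
            have : C * w * X * x ≤ C * w * x * x :=
              mul_le_mul_of_nonneg_right (mul_le_mul_of_nonneg_left hXx (by positivity)) hx0.le
            nlinarith
    have hhigh : ∑ m ∈ (Finset.Ioc h N).filter (fun m ↦ ¬m ≤ X),
        Λ m * Λ (m + h) * min ((m : ℝ) ^ 2 / x) (x ^ 3 / (m : ℝ) ^ 2) ≤ 8 * C * w * x ^ 2 := by
      calc ∑ m ∈ (Finset.Ioc h N).filter (fun m ↦ ¬m ≤ X),
            Λ m * Λ (m + h) * min ((m : ℝ) ^ 2 / x) (x ^ 3 / (m : ℝ) ^ 2)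
          ≤ ∑ m ∈ (Finset.Ioc h N).filter (fun m ↦ ¬m ≤ X),
              Λ m * Λ (m + h) * (x ^ 3 / (m : ℝ) ^ 2) :=
            Finset.sum_le_sum fun m _ ↦ mul_le_mul_of_nonneg_left (min_le_right _ _) (hΛΛ0 m)
        _ ≤ ∑ m ∈ Finset.Ioc X N, Λ m * Λ (m + h) * (x ^ 3 / (m : ℝ) ^ 2) := by
            refine Finset.sum_le_sum_of_subset_of_nonneg (fun m hm ↦ ?_)
              fun m _ _ ↦ mul_nonneg (hΛΛ0 m) (by positivity)
            rw [Finset.mem_filter, Finset.mem_Ioc] at hm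
            rw [Finset.mem_Ioc]; omega
        _ ≤ x ^ 3 * (4 * (C * w) / X) := htail X hhX hX1
        _ ≤ x ^ 3 * (4 * (C * w) / (x / 2)) := by
            refine mul_le_mul_of_nonneg_left ?_ (by positivity)
            exact div_le_div_of_nonneg_left (by positivity) (by positivity) (by linarith)
        _ = 8 * C * w * x ^ 2 := by field_simp; ring
    linarith
  · -- `h > X`: all `m > h > x`
    push Not at hhX
    calc ∑ m ∈ Finset.Ioc h N, Λ m * Λ (m + h) * min ((m : ℝ) ^ 2 / x) (x ^ 3 / (m : ℝ) ^ 2)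
        ≤ ∑ m ∈ Finset.Ioc h N, Λ m * Λ (m + h) * (x ^ 3 / (m : ℝ) ^ 2) :=
          Finset.sum_le_sum fun m _ ↦ mul_le_mul_of_nonneg_left (min_le_right _ _) (hΛΛ0 m)
      _ ≤ x ^ 3 * (4 * (C * w) / h) := htail h le_rfl hh
      _ = 4 * C * x ^ 3 * w / h := by ring

/-! ## The off-diagonal sum -/

/-- **The off-diagonal terms of Montgomery's mean square** (the content of the `O(∑ n |a_n|²) =
O(x² log x)` remainder of the Montgomery–Vaughan mean value theorem in Goldston 2005, (4.6), for the
coefficients `a_n = Λ(n) a_n(x)`, obtained here from the prime-pair sieve bound instead of the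
weighted Hilbert inequality): there is an absolute `C` such that for all `x ≥ 1` and all `N`,
`∑_{1 ≤ m ≠ n ≤ N} a_m a_n · 2/|log n − log m| ≤ C x² (log x + 1)`. [cite: Goldston2005, (4.6)] -/
theorem exists_offDiag_montgomeryCoeff_le :
    ∃ C : ℝ, ∀ x : ℝ, 1 ≤ x → ∀ N : ℕ,
      ∑ m ∈ Finset.Icc 1 N, ∑ n ∈ (Finset.Icc 1 N).erase m,
        montgomeryCoeff x m * montgomeryCoeff x n * (2 / |Real.log n - Real.log m|) ≤
      C * (x ^ 2 * (Real.log x + 1)) := by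
  obtain ⟨Cp, hCp0, hCp⟩ := exists_sum_Ioc_vonMangoldt_mul_shift_le
  set A₀ : ℝ := 13 * (Real.log 4 + 4) with hA₀
  refine ⟨2 * (3 * A₀ ^ 2 + 72 * Cp * 19 + 256 * 3 * Cp), fun x hx N ↦ ?_⟩
  have hx0 : 0 < x := by linarith
  have hlogx : 0 ≤ Real.log x := Real.log_nonneg hx
  set X : ℕ := ⌊x⌋₊ with hX
  have hX1 : 1 ≤ X := Nat.le_floor (by simpa using hx)
  have hXx : (X : ℝ) ≤ x := Nat.floor_le hx0.le
  have hxX : x < X + 1 := Nat.lt_floor_add_one x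
  have hX0 : (0 : ℝ) < X := by exact_mod_cast hX1
  have hX1r : (1 : ℝ) ≤ X := by exact_mod_cast hX1
  have hlogX : Real.log X ≤ Real.log x := Real.log_le_log hX0 hXx
  set s := Finset.Icc 1 N with hs
  set a : ℕ → ℝ := fun n ↦ montgomeryCoeff x n with ha
  have ha0 : ∀ n, 0 ≤ a n := fun n ↦ montgomeryCoeff_nonneg hx0.le n
  set F : ℕ → ℕ → ℝ := fun m n ↦ a m * a n * (2 / |Real.log n - Real.log m|) with hF
  have hF0 : ∀ m n, 0 ≤ F m n := fun m n ↦
    mul_nonneg (mul_nonneg (ha0 m) (ha0 n)) (div_nonneg zero_le_two (abs_nonneg _))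
  have hFsymm : ∀ m n, F m n = F n m := by
    intro m n; simp only [hF]; rw [abs_sub_comm]; ring
  -- Step 1: symmetry
  have hsymm : ∑ m ∈ s, ∑ n ∈ s.erase m, F m n = 2 * ∑ m ∈ s, ∑ n ∈ s.filter (fun n ↦ m < n), F m n := by
    have h1 : ∀ m ∈ s, ∑ n ∈ s.erase m, F m n =
        ∑ n ∈ s.filter (fun n ↦ n < m), F m n + ∑ n ∈ s.filter (fun n ↦ m < n), F m n := by
      intro m _
      rw [← Finset.sum_union]
      · congr 1
        ext n
        simp only [Finset.mem_erase, Finset.mem_union, Finset.mem_filter]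
        constructor
        · rintro ⟨hne, hn⟩
          rcases lt_or_gt_of_ne hne with h | h
          · exact Or.inl ⟨hn, h⟩
          · exact Or.inr ⟨hn, h⟩
        · rintro (⟨hn, h⟩ | ⟨hn, h⟩)
          · exact ⟨h.ne, hn⟩
          · exact ⟨h.ne', hn⟩
      · rw [Finset.disjoint_left]
        intro n h1 h2
        rw [Finset.mem_filter] at h1 h2
        omega
    rw [Finset.sum_congr rfl h1, Finset.sum_add_distrib]
    have h2 : ∑ m ∈ s, ∑ n ∈ s.filter (fun n ↦ n < m), F m n =
        ∑ m ∈ s, ∑ n ∈ s.filter (fun n ↦ m < n), F m n := by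
      calc ∑ m ∈ s, ∑ n ∈ s.filter (fun n ↦ n < m), F m n
          = ∑ m ∈ s, ∑ n ∈ s.filter (fun n ↦ n < m), F n m :=
            Finset.sum_congr rfl fun m _ ↦ Finset.sum_congr rfl fun n _ ↦ hFsymm m n
        _ = ∑ n ∈ s, ∑ m ∈ s.filter (fun m ↦ n < m), F n m := by
            refine Finset.sum_comm' fun m n ↦ ?_
            simp only [Finset.mem_filter]
            tauto
    rw [h2]; ring
  -- Step 2: reindex `n = m + k`
  have hreidx : ∀ m ∈ s, ∑ n ∈ s.filter (fun n ↦ m < n), F m n =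
      ∑ k ∈ Finset.Icc 1 (N - m), F m (m + k) := by
    intro m hm
    rw [hs, Finset.mem_Icc] at hm
    have e : s.filter (fun n ↦ m < n) = (Finset.Icc 1 (N - m)).map (addLeftEmbedding m) := by
      rw [Finset.map_add_left_Icc, show m + (N - m) = N by omega]
      ext n
      simp only [hs, Finset.mem_filter, Finset.mem_Icc]
      omega
    rw [e, Finset.sum_map]
    rfl
  -- Step 3: pointwise bound for `F m (m + k)`
  have hpt : ∀ m k : ℕ, 1 ≤ m → 1 ≤ k → F m (m + k) ≤
      3 * (a m * a (m + k)) +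
        (if k < m then 8 * (Λ m * Λ (m + k) * min ((m : ℝ) ^ 2 / x) (x ^ 3 / (m : ℝ) ^ 2)) / k
          else 0) := by
    intro m k hm hk
    have hm0 : (0 : ℝ) < m := by exact_mod_cast hm
    have hk0 : (0 : ℝ) < k := by exact_mod_cast hk
    have hker := two_div_abs_log_sub_log_le hm hk
    have haa : 0 ≤ a m * a (m + k) := mul_nonneg (ha0 _) (ha0 _)
    have h1 : F m (m + k) ≤ a m * a (m + k) * (3 + (if k < m then 4 * (m : ℝ) / k else 0)) :=
      mul_le_mul_of_nonneg_left hker haa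
    refine h1.trans ?_
    split_ifs with hkm
    · have h2 := mul_montgomeryCoeff_mul_shift_le hx0 hm hkm.le
      have e : a m * a (m + k) * (3 + 4 * (m : ℝ) / k) =
          3 * (a m * a (m + k)) + (4 / k) * ((m : ℝ) * (a m * a (m + k))) := by
        simp only [ha]; field_simp
      rw [e]
      have h3 : (4 / (k : ℝ)) * ((m : ℝ) * (a m * a (m + k))) ≤
          (4 / (k : ℝ)) * (2 * Λ m * Λ (m + k) * min ((m : ℝ) ^ 2 / x) (x ^ 3 / (m : ℝ) ^ 2)) :=
        mul_le_mul_of_nonneg_left h2 (by positivity)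
      have e2 : (4 / (k : ℝ)) * (2 * Λ m * Λ (m + k) * min ((m : ℝ) ^ 2 / x) (x ^ 3 / (m : ℝ) ^ 2)) =
          8 * (Λ m * Λ (m + k) * min ((m : ℝ) ^ 2 / x) (x ^ 3 / (m : ℝ) ^ 2)) / k := by
        field_simp; ring
      linarith
    · rw [add_zero, add_zero]; linarith
  -- Step 4: the far pairs `3 ∑_m a_m ∑_k a_{m+k} ≤ 3 A₀² x²`
  have hA : ∀ M : ℕ, ∑ n ∈ Finset.Icc 1 M, a n ≤ A₀ * x := fun M ↦ sum_Icc_montgomeryCoeff_le hx M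
  have hA₀0 : 0 ≤ A₀ * x := (Finset.sum_nonneg fun n _ ↦ ha0 n).trans (hA 0)
  have hfar : ∑ m ∈ s, ∑ k ∈ Finset.Icc 1 (N - m), 3 * (a m * a (m + k)) ≤ 3 * (A₀ * x) ^ 2 := by
    have h1 : ∀ m ∈ s, ∑ k ∈ Finset.Icc 1 (N - m), 3 * (a m * a (m + k)) ≤ 3 * a m * (A₀ * x) := by
      intro m _
      have e : ∑ k ∈ Finset.Icc 1 (N - m), 3 * (a m * a (m + k)) =
          3 * a m * ∑ k ∈ Finset.Icc 1 (N - m), a (m + k) := by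
        rw [Finset.mul_sum]; refine Finset.sum_congr rfl fun k _ ↦ ?_; ring
      rw [e]
      refine mul_le_mul_of_nonneg_left ?_ (mul_nonneg (by norm_num) (ha0 m))
      have e2 : ∑ k ∈ Finset.Icc 1 (N - m), a (m + k) = ∑ n ∈ Finset.Icc (m + 1) (m + (N - m)), a n := by
        rw [← Finset.map_add_left_Icc, Finset.sum_map]; rfl
      rw [e2]
      calc ∑ n ∈ Finset.Icc (m + 1) (m + (N - m)), a n ≤ ∑ n ∈ Finset.Icc 1 (m + (N - m)), a n :=
            Finset.sum_le_sum_of_subset_of_nonneg (Finset.Icc_subset_Icc_left (by omega))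
              fun n _ _ ↦ ha0 n
        _ ≤ A₀ * x := hA _
    calc ∑ m ∈ s, ∑ k ∈ Finset.Icc 1 (N - m), 3 * (a m * a (m + k))
        ≤ ∑ m ∈ s, 3 * a m * (A₀ * x) := Finset.sum_le_sum h1
      _ = 3 * (A₀ * x) * ∑ m ∈ s, a m := by
          rw [Finset.mul_sum]; refine Finset.sum_congr rfl fun m _ ↦ ?_; ring
      _ ≤ 3 * (A₀ * x) * (A₀ * x) := mul_le_mul_of_nonneg_left (hA N) (by linarith)
      _ = 3 * (A₀ * x) ^ 2 := by ring
  -- Step 5: the near pairs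
  set G : ℕ → ℝ := fun k ↦
    ∑ m ∈ Finset.Ioc k N, Λ m * Λ (m + k) * min ((m : ℝ) ^ 2 / x) (x ^ 3 / (m : ℝ) ^ 2) with hG
  have hG0 : ∀ k, 0 ≤ G k := fun k ↦ Finset.sum_nonneg fun m _ ↦
    mul_nonneg (mul_nonneg vonMangoldt_nonneg vonMangoldt_nonneg) (le_min (by positivity) (by positivity))
  set P : ℕ → ℕ → ℝ := fun m k ↦
    if k < m then 8 * (Λ m * Λ (m + k) * min ((m : ℝ) ^ 2 / x) (x ^ 3 / (m : ℝ) ^ 2)) / k else 0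
    with hP
  have hP0 : ∀ m k, 0 ≤ P m k := by
    intro m k; simp only [hP]; split_ifs
    · exact div_nonneg (mul_nonneg (by norm_num) (mul_nonneg (mul_nonneg vonMangoldt_nonneg
        vonMangoldt_nonneg) (le_min (by positivity) (by positivity)))) (Nat.cast_nonneg k)
    · exact le_rfl
  have hnear : ∑ m ∈ s, ∑ k ∈ Finset.Icc 1 (N - m), P m k ≤ ∑ k ∈ Finset.Icc 1 N, 8 / (k : ℝ) * G k := by
    calc ∑ m ∈ s, ∑ k ∈ Finset.Icc 1 (N - m), P m k ≤ ∑ m ∈ s, ∑ k ∈ Finset.Icc 1 N, P m k := by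
          refine Finset.sum_le_sum fun m _ ↦ ?_
          exact Finset.sum_le_sum_of_subset_of_nonneg (Finset.Icc_subset_Icc_right (Nat.sub_le N m))
            fun k _ _ ↦ hP0 m k
      _ = ∑ k ∈ Finset.Icc 1 N, ∑ m ∈ s, P m k := Finset.sum_comm
      _ = ∑ k ∈ Finset.Icc 1 N, 8 / (k : ℝ) * G k := by
          refine Finset.sum_congr rfl fun k hk ↦ ?_
          simp only [hP, hG]
          rw [Finset.mul_sum, ← Finset.sum_filter]
          rw [show s.filter (fun m ↦ k < m) = Finset.Ioc k N by
            ext m; simp only [hs, Finset.mem_filter, Finset.mem_Icc, Finset.mem_Ioc]; omega]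
          refine Finset.sum_congr rfl fun m _ ↦ ?_
          ring
  -- Step 6: bound `∑_k (8/k) G k`
  have hGle : ∀ k : ℕ, 1 ≤ k → G k ≤
      if k ≤ X then 9 * Cp * ((k : ℝ) / Nat.totient k) * x ^ 2
      else 4 * Cp * x ^ 3 * ((k : ℝ) / Nat.totient k) / k :=
    fun k hk ↦ sum_Ioc_pairTerm_le hCp0 hCp hx hk N
  have hsumG : ∑ k ∈ Finset.Icc 1 N, 8 / (k : ℝ) * G k ≤
      72 * Cp * x ^ 2 * (7 + 12 * Real.log x) + 256 * Real.exp 1 * Cp * x ^ 2 := by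
    rw [← Finset.sum_filter_add_sum_filter_not (Finset.Icc 1 N) (fun k ↦ k ≤ X)]
    have hlow : ∑ k ∈ (Finset.Icc 1 N).filter (fun k ↦ k ≤ X), 8 / (k : ℝ) * G k ≤
        72 * Cp * x ^ 2 * (7 + 12 * Real.log x) := by
      calc ∑ k ∈ (Finset.Icc 1 N).filter (fun k ↦ k ≤ X), 8 / (k : ℝ) * G k
          ≤ ∑ k ∈ (Finset.Icc 1 N).filter (fun k ↦ k ≤ X),
              72 * Cp * x ^ 2 * (1 / (Nat.totient k : ℝ)) := by
            refine Finset.sum_le_sum fun k hk ↦ ?_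
            rw [Finset.mem_filter, Finset.mem_Icc] at hk
            have hk0 : (0 : ℝ) < k := by exact_mod_cast hk.1.1
            have h1 := hGle k hk.1.1
            rw [if_pos hk.2] at h1
            calc 8 / (k : ℝ) * G k ≤ 8 / (k : ℝ) * (9 * Cp * ((k : ℝ) / Nat.totient k) * x ^ 2) :=
                  mul_le_mul_of_nonneg_left h1 (by positivity)
              _ = 72 * Cp * x ^ 2 * (1 / (Nat.totient k : ℝ)) := by field_simp; ring
          _ ≤ ∑ k ∈ Finset.Icc 1 X, 72 * Cp * x ^ 2 * (1 / (Nat.totient k : ℝ)) := by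
            refine Finset.sum_le_sum_of_subset_of_nonneg (fun k hk ↦ ?_) fun k _ _ ↦ by positivity
            rw [Finset.mem_filter, Finset.mem_Icc] at hk
            rw [Finset.mem_Icc]; omega
          _ = 72 * Cp * x ^ 2 * ∑ k ∈ Finset.Icc 1 X, 1 / (Nat.totient k : ℝ) := by
            rw [Finset.mul_sum]
          _ ≤ 72 * Cp * x ^ 2 * (7 + 12 * Real.log X) :=
            mul_le_mul_of_nonneg_left (sum_Icc_inv_totient_le X) (by positivity)
          _ ≤ 72 * Cp * x ^ 2 * (7 + 12 * Real.log x) := by gcongr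
    have hhigh : ∑ k ∈ (Finset.Icc 1 N).filter (fun k ↦ ¬k ≤ X), 8 / (k : ℝ) * G k ≤
        256 * Real.exp 1 * Cp * x ^ 2 := by
      calc ∑ k ∈ (Finset.Icc 1 N).filter (fun k ↦ ¬k ≤ X), 8 / (k : ℝ) * G k
          ≤ ∑ k ∈ (Finset.Icc 1 N).filter (fun k ↦ ¬k ≤ X),
              32 * Cp * x ^ 3 * (((k : ℝ) / Nat.totient k) / (k : ℝ) ^ 2) := by
            refine Finset.sum_le_sum fun k hk ↦ ?_
            rw [Finset.mem_filter, Finset.mem_Icc] at hk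
            have hk0 : (0 : ℝ) < k := by exact_mod_cast hk.1.1
            have h1 := hGle k hk.1.1
            rw [if_neg hk.2] at h1
            calc 8 / (k : ℝ) * G k ≤ 8 / (k : ℝ) * (4 * Cp * x ^ 3 * ((k : ℝ) / Nat.totient k) / k) :=
                  mul_le_mul_of_nonneg_left h1 (by positivity)
              _ = 32 * Cp * x ^ 3 * (((k : ℝ) / Nat.totient k) / (k : ℝ) ^ 2) := by
                  field_simp; ring
          _ ≤ ∑ k ∈ Finset.Ioc X N, 32 * Cp * x ^ 3 * (((k : ℝ) / Nat.totient k) / (k : ℝ) ^ 2) := by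
            refine Finset.sum_le_sum_of_subset_of_nonneg (fun k hk ↦ ?_) fun k _ _ ↦ by positivity
            rw [Finset.mem_filter, Finset.mem_Icc] at hk
            rw [Finset.mem_Ioc]; omega
          _ = 32 * Cp * x ^ 3 * ∑ k ∈ Finset.Ioc X N, ((k : ℝ) / Nat.totient k) / (k : ℝ) ^ 2 := by
            rw [Finset.mul_sum]
          _ ≤ 32 * Cp * x ^ 3 * (4 * Real.exp 1 / X) :=
            mul_le_mul_of_nonneg_left (sum_Ioc_div_totient_div_sq_le hX1 N) (by positivity)
          _ ≤ 32 * Cp * x ^ 3 * (4 * Real.exp 1 / (x / 2)) := by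
            refine mul_le_mul_of_nonneg_left ?_ (by positivity)
            exact div_le_div_of_nonneg_left (by positivity) (by positivity) (by linarith)
          _ = 256 * Real.exp 1 * Cp * x ^ 2 := by field_simp; ring
    linarith
  -- Step 7: assemble
  have he : Real.exp 1 < 2.7182818286 := Real.exp_one_lt_d9
  have hmain : ∑ m ∈ s, ∑ n ∈ s.filter (fun n ↦ m < n), F m n ≤
      3 * (A₀ * x) ^ 2 + (72 * Cp * x ^ 2 * (7 + 12 * Real.log x) + 256 * Real.exp 1 * Cp * x ^ 2) := by
    calc ∑ m ∈ s, ∑ n ∈ s.filter (fun n ↦ m < n), F m n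
        = ∑ m ∈ s, ∑ k ∈ Finset.Icc 1 (N - m), F m (m + k) := Finset.sum_congr rfl hreidx
      _ ≤ ∑ m ∈ s, ∑ k ∈ Finset.Icc 1 (N - m), (3 * (a m * a (m + k)) + P m k) := by
          refine Finset.sum_le_sum fun m hm ↦ Finset.sum_le_sum fun k hk ↦ ?_
          rw [hs, Finset.mem_Icc] at hm
          rw [Finset.mem_Icc] at hk
          exact hpt m k hm.1 hk.1
      _ = ∑ m ∈ s, ∑ k ∈ Finset.Icc 1 (N - m), 3 * (a m * a (m + k)) +
            ∑ m ∈ s, ∑ k ∈ Finset.Icc 1 (N - m), P m k := by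
          rw [← Finset.sum_add_distrib]
          exact Finset.sum_congr rfl fun m _ ↦ Finset.sum_add_distrib
      _ ≤ 3 * (A₀ * x) ^ 2 + ∑ k ∈ Finset.Icc 1 N, 8 / (k : ℝ) * G k := add_le_add hfar hnear
      _ ≤ 3 * (A₀ * x) ^ 2 +
            (72 * Cp * x ^ 2 * (7 + 12 * Real.log x) + 256 * Real.exp 1 * Cp * x ^ 2) := by
          linarith [hsumG]
  have hx2 : 0 ≤ x ^ 2 := by positivity
  have hCx : 0 ≤ Cp * x ^ 2 := by positivity
  have hClx : 0 ≤ Cp * x ^ 2 * Real.log x := by positivity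
  calc ∑ m ∈ s, ∑ n ∈ s.erase m, F m n = 2 * ∑ m ∈ s, ∑ n ∈ s.filter (fun n ↦ m < n), F m n := hsymm
    _ ≤ 2 * (3 * (A₀ * x) ^ 2 +
          (72 * Cp * x ^ 2 * (7 + 12 * Real.log x) + 256 * Real.exp 1 * Cp * x ^ 2)) := by linarith
    _ ≤ 2 * (3 * A₀ ^ 2 + 72 * Cp * 19 + 256 * 3 * Cp) * (x ^ 2 * (Real.log x + 1)) := by
        nlinarith [sq_nonneg A₀]

end Montgomery

end Literature.NumberTheory.LFunctions
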